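/-
Copyright (c) 2026 the pub-hodgecm-mathlib formalisation cell (harness21).  Seat hodgecm-mathlib-F0P3a-p01 (g30): heir LEAD F0P3a-plan (g19) T18-06 (R-16) ORDER «RC-1»
(declared reshape, class refuted-MISSTATED-by-census; director g36 s1825; dealer LH4-plan (g10) WORD #28∕#29; referee ref4 R4-91∕R4-92, REF5 R5-12).  2026-09-03.
-/
import Summits.HodgeConjecture.HodgeConjecture.Theorems.F0P3cDyRamFourFrameLawDefs   -- ★ DEFS LEAF №1 «LAW-DEFS» (p854575): `StableLaw(At)`, `KappaAmplitudeLaw(At)`, `KappaSignLaw(At)`, `DyadicFence`, … — UNCHANGED, re-bundled by import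
import HarnessLib

/-!
# F0 · P3c · line LH4 «(D-RAM) FOUR-FRAME» — DEFS LEAF №1-R «LAW-DEFS RE-CUT» (RC-1): the κ-laws with the depth-shift token as a SCHEDULE `shift d t`,
# the re-cut schedule of record `shiftR d t = d − d mod 2` (t-free), the `Iff.rfl` ties to the defs of record (`shift d t = t`), and the maximal-type agreement lemma

WHY (evidence `F0/P3a/F0P3a-p01/g30/qf-e2c/README.md` 49dbca7c68a4b970, rows `frames4.e2c.json` 0ec7e07ef22846ab; independent re-fit ref4 R4-92 «=»; LEAD T18-06 (R-16) verdict
(s2)-class «≠», provisional → of record on REF5∕ref4 re-fits).  At the first census cell with `d < t = v_E(2)` — e2c: `F = ℚ₂(√2)`, `E = F(√(1+2√2))`, `d = 2`, `t = 4` — the STABLE law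
(S) of record holds 9∕9 keys EXACT, but the κ-AMPLITUDE token of record `2B_i = n_i − d + 2 − 2t` (★ №1 :87 :106 :144 :157) FAILS on 21∕21 in-range slots, while the ONE-TOKEN re-cut
`2B_i = n_i − d + 2 − 2(d − d mod 2)` fits 54∕54 values and COINCIDES with the token of record on every earlier cell: for a ramified quadratic datum `d ∈ {2, 4, …, t} ∪ {t + 1}`
(ref4 R4-91 (1)), so `d − d mod 2 = min(d, t)`, which is `t` exactly on the maximal types `d ∈ {t, t+1}` — all cells of record (ℚ₂: `d ∈ {2,3}, t = 2`; q = 4; e_F = 2 with `d ∈ {4,5}`).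
DESIGN (never re-word a ★ def in place — supersede BY NAME; keep the token refutable): §S the κ-laws of ★ №1 §K∕§1 VERBATIM except that the shift `t` in the parity datum
becomes a SCHEDULE `shift : ℕ → ℕ → ℤ` evaluated at `(d, t)` — `KappaAmplitudeLawS ∕ KappaSignLawS shift N₀ τ`, place-wise cuts `KappaAmplitudeLawAtS ∕ KappaSignLawAtS shift N₀ τ σ ϖ d t`,
`Iff.rfl` ties; §R the two schedules — `shiftT d t = t` (OF RECORD until tonight: `KappaAmplitudeLawAtS shiftT = KappaAmplitudeLawAt` by `Iff.rfl`, the CUSTODY TIE to the 520 + 14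
values of record) and `shiftR d t = d − d mod 2` (THE RE-CUT, t-free) with the R-names the LEAD asked for (`KappaAmplitudeLawR := KappaAmplitudeLawS shiftR`, …, `FourFrameLawsWildAtR`,
`FourFrameLawsWildR`, `FourFrameLawsWildOfRecordR`); §A the AGREEMENT: behind `IsRamifiedQuadraticDatum σ ϖ d t` (which forces `t` even) and `d ∈ {t, t+1}` the two tokens are
the same integer (`shiftR_eq_shiftT_of_maximal`), hence `KappaAmplitudeLawAtR ↔ KappaAmplitudeLawAt` and `KappaSignLawAtR ↔ KappaSignLawAt` there
(`kappaAmplitudeLawAtR_iff_of_maximal`, `kappaSignLawAtR_iff_of_maximal`, `fourFrameLawsWildAtR_iff_of_maximal`) — so nothing checked before is lost and the two versions differ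
exactly on `d ≤ t − 2` (e_F ≥ 2).  The (S) law, the fence, the (ii-0) Props are ★ №1's, imported, not copied.  DEF LANE: `def`s + `Iff.rfl`∕one-line ties only; no instance,
no notation, no sorry, no law asserted.  EVERY PROP HERE IS A CENSUS LAW — an empirical regularity (now 520 + 14 + 54 values), a PROVER TARGET, never a literature fact.
SECOND-CELL CAVEAT (ref4 R4-91 (4), LEAD (3)(b)(ii)): the re-cut rests on ONE `d < t` cell; any t-free token `f(d)` with `f(2) = 2` fits e2c; its t-independence and d-slope are
to be tested at `e_F = 3` (`F = ℚ₂(∛2)`: `d = 2, 4 < t = 6`) before a κ-STUB over these names is written — which is why the shift is a schedule here: a third re-fit changes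
`shiftR` only.  RISK LINE (LEAD T18-07 (1), verbatim): «t-free token fitted on ONE d < t cell (e2c); d = 2∕4 at t = 6 (e3a, req629) pending».
HONEST LABEL: HC_CM is proved only modulo the 7 printed citations (2 remaining: hLiu418 = stmt-HodgeConjecture-24832, h413 = stmt-HodgeConjecture-24833) until rung 0 closes;
this file asserts nothing (count-neutral vehicle).

## References
* [Rogawski1990] J. D. Rogawski, *Automorphic Representations of Unitary Groups in Three Variables*, Ann. of Math. Stud. 123 (1990): §4.9 Prop. 4.9.1 (a) p. 55, §12.2.
* [Kottwitz1986BaseChangeUnits] R. Kottwitz, *Base change for unit elements of Hecke algebras*, Compositio Math. 60 (1986), §3.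
* [Serre1979] J.-P. Serre, *Local Fields*, GTM 67 (1979): Ch. IV §1–§2, Ch. XV §2 (the different ∕ conductor of a wildly ramified quadratic extension: `d ∈ {2, …, 2e_F} ∪ {2e_F + 1}`).
-/

noncomputable section

namespace Summit.HodgeConjecture.HodgeConjecture.Cruxes.H413.F0P3cDyRamFourFrameLawDefsR

open scoped Valued WithZero Matrix MatrixGroups
open Finset Classical
open Literature.NumberTheory.Automorphic Literature.NumberTheory.Automorphic.HermitianLattice
  Literature.NumberTheory.Automorphic.UnitaryLatticeTree Literature.NumberTheory.Automorphic.UnitaryThreeFourFrame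
open Summit.HodgeConjecture.HodgeConjecture.Cruxes.H413.F0P3cDyRamFourFrameLawDefs

/-! ## §S  The κ-laws with the depth shift as a SCHEDULE `shift d t` (★ №1 §K∕§1 bodies VERBATIM except the token `2 * t ↦ 2 * shift d t`) -/

/-- K-ABS-S · the κ-AMPLITUDE LAW of ★ №1 (`KappaAmplitudeLaw`, :80) with the parity datum `2B_i = n_i − d + 2 − 2·shift d t` for a depth-shift SCHEDULE `shift`
(`shift d t = t` is the law of record; `shift d t = d − d mod 2` the RC-1 re-cut).  CENSUS LAW — empirical, a PROVER TARGET, nothing asserted. -/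
def KappaAmplitudeLawS (shift : ℕ → ℕ → ℤ) (N₀ : ℕ → ℕ) (τ : ℕ → ℤ) : Prop :=
  ∀ {K : Type} [Field K] [Valued K ℤᵐ⁰] [CompleteSpace K] [Fintype 𝓀[K]] (σ : K →+* K) (ϖ : K) (d t : ℕ),
    IsRamifiedQuadraticDatum σ ϖ d t →
    ∀ (f : Fin 4 → Fin 3 → (Fin 3 → K)), IsFourFrameFamily σ f →
    ∀ (α β : K) (n₁ n₂ n₃ : ℕ), IsElementDatum σ ϖ (N₀ d) α β n₁ n₂ n₃ →
    ∀ (Γ : Fin 4 → GL (Fin 3) K), (∀ b, (Γ b : Matrix (Fin 3) (Fin 3) K) = frameElt σ f b α β) →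
    ∀ (k : ℕ), 2 * k + d = n₁ + n₂ + n₃ + 2 →
    ∀ (i : Fin 3) (B : ℤ), 2 * B = ((![n₁, n₂, n₃] : Fin 3 → ℕ) i : ℤ) - d + 2 - 2 * shift d t →
      |((∑ b : Fin 4, kappaChar i b * (fixedVertexCount σ ϖ 0 (Γ b) : ℤ) : ℤ) : ℚ)| = ampl (Fintype.card 𝓀[K]) k B ∧
      |((∑ b : Fin 4, kappaChar i b * (fixedVertexCount σ ϖ 2 (Γ b) : ℤ) : ℤ) : ℚ)| = ampl (Fintype.card 𝓀[K]) k (B + τ d)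

/-- K-SGN-S · the κ-SIGN LAW of ★ №1 (`KappaSignLaw`, :97) with the schedule token `2·shift d t`.  CENSUS LAW — a PROVER TARGET, nothing asserted. -/
def KappaSignLawS (shift : ℕ → ℕ → ℤ) (N₀ : ℕ → ℕ) (τ : ℕ → ℤ) : Prop :=
  ∀ {K : Type} [Field K] [Valued K ℤᵐ⁰] [CompleteSpace K] [Fintype 𝓀[K]] (σ : K →+* K) (ϖ : K) (d t : ℕ),
    IsRamifiedQuadraticDatum σ ϖ d t →
    ∀ (f : Fin 4 → Fin 3 → (Fin 3 → K)), IsFourFrameFamily σ f →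
    ∀ (δ : K), σ δ = -δ → δ ≠ 0 →
    ∀ (a b : K), a * σ a = 1 → b * σ b = 1 → Valued.v (a - 1) < Valued.v (2 : K) → Valued.v (b - 1) < Valued.v (2 : K) →
    ∀ (n₁ n₂ n₃ : ℕ), IsElementDatum σ ϖ (N₀ d) (a * a) (b * b) n₁ n₂ n₃ →
    ∀ (Γ : Fin 4 → GL (Fin 3) K), (∀ b', (Γ b' : Matrix (Fin 3) (Fin 3) K) = frameElt σ f b' (a * a) (b * b)) →
    ∀ (k : ℕ), 2 * k + d = n₁ + n₂ + n₃ + 2 →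
    ∀ (i : Fin 3) (B : ℤ), 2 * B = ((![n₁, n₂, n₃] : Fin 3 → ℕ) i : ℤ) - d + 2 - 2 * shift d t →
      ((∑ b' : Fin 4, kappaChar i b' * (fixedVertexCount σ ϖ 0 (Γ b') : ℤ) : ℤ) : ℚ) =
          (baseSign σ i * normSign σ (fPartProd δ ![a, b, 1] i) : ℤ) * ampl (Fintype.card 𝓀[K]) k B ∧
      ((∑ b' : Fin 4, kappaChar i b' * (fixedVertexCount σ ϖ 2 (Γ b') : ℤ) : ℤ) : ℚ) =
          (baseSign σ i * normSign σ (fPartProd δ ![a, b, 1] i) : ℤ) * ampl (Fintype.card 𝓀[K]) k (B + τ d)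

/-- K-ABS-S-At · `KappaAmplitudeLawS shift N₀ τ` AT ONE DATUM (★ №1 `KappaAmplitudeLawAt` :138 with the schedule token). -/
def KappaAmplitudeLawAtS {K : Type} [Field K] [Valued K ℤᵐ⁰] [CompleteSpace K] [Fintype 𝓀[K]] (shift : ℕ → ℕ → ℤ) (N₀ : ℕ → ℕ) (τ : ℕ → ℤ) (σ : K →+* K) (ϖ : K) (d t : ℕ) : Prop :=
    IsRamifiedQuadraticDatum σ ϖ d t →
    ∀ (f : Fin 4 → Fin 3 → (Fin 3 → K)), IsFourFrameFamily σ f →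
    ∀ (α β : K) (n₁ n₂ n₃ : ℕ), IsElementDatum σ ϖ (N₀ d) α β n₁ n₂ n₃ →
    ∀ (Γ : Fin 4 → GL (Fin 3) K), (∀ b, (Γ b : Matrix (Fin 3) (Fin 3) K) = frameElt σ f b α β) →
    ∀ (k : ℕ), 2 * k + d = n₁ + n₂ + n₃ + 2 →
    ∀ (i : Fin 3) (B : ℤ), 2 * B = ((![n₁, n₂, n₃] : Fin 3 → ℕ) i : ℤ) - d + 2 - 2 * shift d t →
      |((∑ b : Fin 4, kappaChar i b * (fixedVertexCount σ ϖ 0 (Γ b) : ℤ) : ℤ) : ℚ)| = ampl (Fintype.card 𝓀[K]) k B ∧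
      |((∑ b : Fin 4, kappaChar i b * (fixedVertexCount σ ϖ 2 (Γ b) : ℤ) : ℤ) : ℚ)| = ampl (Fintype.card 𝓀[K]) k (B + τ d)

/-- K-SGN-S-At · `KappaSignLawS shift N₀ τ` AT ONE DATUM (★ №1 `KappaSignLawAt` :149 with the schedule token). -/
def KappaSignLawAtS {K : Type} [Field K] [Valued K ℤᵐ⁰] [CompleteSpace K] [Fintype 𝓀[K]] (shift : ℕ → ℕ → ℤ) (N₀ : ℕ → ℕ) (τ : ℕ → ℤ) (σ : K →+* K) (ϖ : K) (d t : ℕ) : Prop :=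
    IsRamifiedQuadraticDatum σ ϖ d t →
    ∀ (f : Fin 4 → Fin 3 → (Fin 3 → K)), IsFourFrameFamily σ f →
    ∀ (δ : K), σ δ = -δ → δ ≠ 0 →
    ∀ (a b : K), a * σ a = 1 → b * σ b = 1 → Valued.v (a - 1) < Valued.v (2 : K) → Valued.v (b - 1) < Valued.v (2 : K) →
    ∀ (n₁ n₂ n₃ : ℕ), IsElementDatum σ ϖ (N₀ d) (a * a) (b * b) n₁ n₂ n₃ →
    ∀ (Γ : Fin 4 → GL (Fin 3) K), (∀ b', (Γ b' : Matrix (Fin 3) (Fin 3) K) = frameElt σ f b' (a * a) (b * b)) →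
    ∀ (k : ℕ), 2 * k + d = n₁ + n₂ + n₃ + 2 →
    ∀ (i : Fin 3) (B : ℤ), 2 * B = ((![n₁, n₂, n₃] : Fin 3 → ℕ) i : ℤ) - d + 2 - 2 * shift d t →
      ((∑ b' : Fin 4, kappaChar i b' * (fixedVertexCount σ ϖ 0 (Γ b') : ℤ) : ℤ) : ℚ) =
          (baseSign σ i * normSign σ (fPartProd δ ![a, b, 1] i) : ℤ) * ampl (Fintype.card 𝓀[K]) k B ∧
      ((∑ b' : Fin 4, kappaChar i b' * (fixedVertexCount σ ϖ 2 (Γ b') : ℤ) : ℤ) : ℚ) =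
          (baseSign σ i * normSign σ (fPartProd δ ![a, b, 1] i) : ℤ) * ampl (Fintype.card 𝓀[K]) k (B + τ d)

/-- (S1)-S tie · the closed `KappaAmplitudeLawS` IS the conjunction of its place-wise cuts — `Iff.rfl`. -/
theorem kappaAmplitudeLawS_iff_forall_at (shift : ℕ → ℕ → ℤ) (N₀ : ℕ → ℕ) (τ : ℕ → ℤ) :
    KappaAmplitudeLawS shift N₀ τ ↔ ∀ {K : Type} [Field K] [Valued K ℤᵐ⁰] [CompleteSpace K] [Fintype 𝓀[K]] (σ : K →+* K) (ϖ : K) (d t : ℕ), KappaAmplitudeLawAtS shift N₀ τ σ ϖ d t :=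
  Iff.rfl

/-- (S1)-S tie · `KappaSignLawS` ↔ its place-wise cuts — `Iff.rfl`. -/
theorem kappaSignLawS_iff_forall_at (shift : ℕ → ℕ → ℤ) (N₀ : ℕ → ℕ) (τ : ℕ → ℤ) :
    KappaSignLawS shift N₀ τ ↔ ∀ {K : Type} [Field K] [Valued K ℤᵐ⁰] [CompleteSpace K] [Fintype 𝓀[K]] (σ : K →+* K) (ϖ : K) (d t : ℕ), KappaSignLawAtS shift N₀ τ σ ϖ d t :=
  Iff.rfl

/-- W-S-At · the fenced conjunction (S)At ∧ (K-ABS-S)At ∧ (K-SGN-S)At at one datum (★ №1 `FourFrameLawsWildAt` with the schedule token; the stable cut and the fence are ★ №1's own). -/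
def FourFrameLawsWildAtS {K : Type} [Field K] [Valued K ℤᵐ⁰] [CompleteSpace K] [Fintype 𝓀[K]] (shift : ℕ → ℕ → ℤ) (N₀ : ℕ → ℕ) (τ : ℕ → ℤ) (σ : K →+* K) (ϖ : K) (d t : ℕ) : Prop :=
    DyadicFence (K := K) (StableLawAt N₀ σ ϖ d t ∧ KappaAmplitudeLawAtS shift N₀ τ σ ϖ d t ∧ KappaSignLawAtS shift N₀ τ σ ϖ d t)

/-- W-S · the fenced laws at every complete datum with finite residue field, schedule version. -/
def FourFrameLawsWildS (shift : ℕ → ℕ → ℤ) (N₀ : ℕ → ℕ) (τ : ℕ → ℤ) : Prop :=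
    ∀ {K : Type} [Field K] [Valued K ℤᵐ⁰] [CompleteSpace K] [Fintype 𝓀[K]] (σ : K →+* K) (ϖ : K) (d t : ℕ), FourFrameLawsWildAtS shift N₀ τ σ ϖ d t

/-- W-S · the closed laws imply the fenced wild conjunction (the fence and the cuts only weaken). -/
theorem fourFrameLawsWildS_of_laws (shift : ℕ → ℕ → ℤ) (N₀ : ℕ → ℕ) (τ : ℕ → ℤ)
    (hS : StableLaw N₀) (hKA : KappaAmplitudeLawS shift N₀ τ) (hKS : KappaSignLawS shift N₀ τ) : FourFrameLawsWildS shift N₀ τ :=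
  fun σ ϖ d t => dyadicFence_of ⟨hS σ ϖ d t, hKA σ ϖ d t, hKS σ ϖ d t⟩

/-! ## §R  The two schedules: `shiftT` (of record until RC-1) and `shiftR` (the re-cut), the `Iff.rfl` custody ties, and the R-names -/

/-- R0 · THE SHIFT OF RECORD UNTIL RC-1: `shift d t = t = v_E(2)` (★ №1's literal token). -/
def shiftT : ℕ → ℕ → ℤ := fun _ t => (t : ℤ)

/-- R1 · THE RC-1 RE-CUT SHIFT: `shift d t = d − d mod 2 = 2⌊d∕2⌋` (t-FREE; `= min(d, t)` on every ramified quadratic datum; e2c 54∕54, equal to `shiftT` on all earlier cells). -/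
def shiftR : ℕ → ℕ → ℤ := fun d _ => ((d - d % 2 : ℕ) : ℤ)

/-- CUSTODY TIE · at the schedule of record the S-law IS ★ №1's `KappaAmplitudeLawAt` — `Iff.rfl` (so the 520 + 14 checked values of record are values of the S-family). -/
theorem kappaAmplitudeLawAtS_shiftT_iff {K : Type} [Field K] [Valued K ℤᵐ⁰] [CompleteSpace K] [Fintype 𝓀[K]] (N₀ : ℕ → ℕ) (τ : ℕ → ℤ) (σ : K →+* K) (ϖ : K) (d t : ℕ) :
    KappaAmplitudeLawAtS shiftT N₀ τ σ ϖ d t ↔ KappaAmplitudeLawAt N₀ τ σ ϖ d t :=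
  Iff.rfl

/-- CUSTODY TIE · `KappaSignLawAtS shiftT = KappaSignLawAt` — `Iff.rfl`. -/
theorem kappaSignLawAtS_shiftT_iff {K : Type} [Field K] [Valued K ℤᵐ⁰] [CompleteSpace K] [Fintype 𝓀[K]] (N₀ : ℕ → ℕ) (τ : ℕ → ℤ) (σ : K →+* K) (ϖ : K) (d t : ℕ) :
    KappaSignLawAtS shiftT N₀ τ σ ϖ d t ↔ KappaSignLawAt N₀ τ σ ϖ d t :=
  Iff.rfl

/-- CUSTODY TIE · closed forms: `KappaAmplitudeLawS shiftT = KappaAmplitudeLaw`, `Iff.rfl`. -/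
theorem kappaAmplitudeLawS_shiftT_iff (N₀ : ℕ → ℕ) (τ : ℕ → ℤ) : KappaAmplitudeLawS shiftT N₀ τ ↔ KappaAmplitudeLaw N₀ τ :=
  Iff.rfl

/-- CUSTODY TIE · `KappaSignLawS shiftT = KappaSignLaw`, `Iff.rfl`. -/
theorem kappaSignLawS_shiftT_iff (N₀ : ℕ → ℕ) (τ : ℕ → ℤ) : KappaSignLawS shiftT N₀ τ ↔ KappaSignLaw N₀ τ :=
  Iff.rfl

/-- CUSTODY TIE · `FourFrameLawsWildAtS shiftT = FourFrameLawsWildAt`, `Iff.rfl`. -/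
theorem fourFrameLawsWildAtS_shiftT_iff {K : Type} [Field K] [Valued K ℤᵐ⁰] [CompleteSpace K] [Fintype 𝓀[K]] (N₀ : ℕ → ℕ) (τ : ℕ → ℤ) (σ : K →+* K) (ϖ : K) (d t : ℕ) :
    FourFrameLawsWildAtS shiftT N₀ τ σ ϖ d t ↔ FourFrameLawsWildAt N₀ τ σ ϖ d t :=
  Iff.rfl

/-- K-ABS-R · THE RE-CUT κ-AMPLITUDE LAW (RC-1): `KappaAmplitudeLawS shiftR`.  CENSUS LAW — a PROVER TARGET, nothing asserted. -/
def KappaAmplitudeLawR (N₀ : ℕ → ℕ) (τ : ℕ → ℤ) : Prop := KappaAmplitudeLawS shiftR N₀ τ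

/-- K-SGN-R · THE RE-CUT κ-SIGN LAW (RC-1): `KappaSignLawS shiftR`.  CENSUS LAW — a PROVER TARGET, nothing asserted. -/
def KappaSignLawR (N₀ : ℕ → ℕ) (τ : ℕ → ℤ) : Prop := KappaSignLawS shiftR N₀ τ

/-- K-ABS-R-At · the re-cut κ-amplitude law at one datum. -/
def KappaAmplitudeLawAtR {K : Type} [Field K] [Valued K ℤᵐ⁰] [CompleteSpace K] [Fintype 𝓀[K]] (N₀ : ℕ → ℕ) (τ : ℕ → ℤ) (σ : K →+* K) (ϖ : K) (d t : ℕ) : Prop :=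
    KappaAmplitudeLawAtS shiftR N₀ τ σ ϖ d t

/-- K-SGN-R-At · the re-cut κ-sign law at one datum. -/
def KappaSignLawAtR {K : Type} [Field K] [Valued K ℤᵐ⁰] [CompleteSpace K] [Fintype 𝓀[K]] (N₀ : ℕ → ℕ) (τ : ℕ → ℤ) (σ : K →+* K) (ϖ : K) (d t : ℕ) : Prop :=
    KappaSignLawAtS shiftR N₀ τ σ ϖ d t

/-- (S1)-R tie · `KappaAmplitudeLawR` ↔ its place-wise cuts — `Iff.rfl`. -/
theorem kappaAmplitudeLawR_iff_forall_at (N₀ : ℕ → ℕ) (τ : ℕ → ℤ) :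
    KappaAmplitudeLawR N₀ τ ↔ ∀ {K : Type} [Field K] [Valued K ℤᵐ⁰] [CompleteSpace K] [Fintype 𝓀[K]] (σ : K →+* K) (ϖ : K) (d t : ℕ), KappaAmplitudeLawAtR N₀ τ σ ϖ d t :=
  Iff.rfl

/-- (S1)-R tie · `KappaSignLawR` ↔ its place-wise cuts — `Iff.rfl`. -/
theorem kappaSignLawR_iff_forall_at (N₀ : ℕ → ℕ) (τ : ℕ → ℤ) :
    KappaSignLawR N₀ τ ↔ ∀ {K : Type} [Field K] [Valued K ℤᵐ⁰] [CompleteSpace K] [Fintype 𝓀[K]] (σ : K →+* K) (ϖ : K) (d t : ℕ), KappaSignLawAtR N₀ τ σ ϖ d t :=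
  Iff.rfl

/-- W-R-At · THE RE-CUT FOUR-FRAME LAWS AT ONE WILD DATUM: behind the fence, (S)At ∧ (K-ABS-R)At ∧ (K-SGN-R)At.  A PROVER TARGET, nothing asserted. -/
def FourFrameLawsWildAtR {K : Type} [Field K] [Valued K ℤᵐ⁰] [CompleteSpace K] [Fintype 𝓀[K]] (N₀ : ℕ → ℕ) (τ : ℕ → ℤ) (σ : K →+* K) (ϖ : K) (d t : ℕ) : Prop :=
    FourFrameLawsWildAtS shiftR N₀ τ σ ϖ d t

/-- W-R · the re-cut fenced laws at every complete datum with finite residue field. -/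
def FourFrameLawsWildR (N₀ : ℕ → ℕ) (τ : ℕ → ℤ) : Prop := FourFrameLawsWildS shiftR N₀ τ

/-- (iii-rec)-R · the re-cut fenced wild laws AT THE PARAMETERS OF RECORD `(depthOfRecord, tauOfRecord)` — the closed Prop the line's layer-2 κ-law theorems now conclude BY NAME. -/
def FourFrameLawsWildOfRecordR : Prop := FourFrameLawsWildR depthOfRecord tauOfRecord

/-- W-R · unfolding: `FourFrameLawsWildAtR` is the fenced conjunction of ★ №1's stable cut and the two R-cuts — `Iff.rfl`. -/
theorem fourFrameLawsWildAtR_iff {K : Type} [Field K] [Valued K ℤᵐ⁰] [CompleteSpace K] [Fintype 𝓀[K]] (N₀ : ℕ → ℕ) (τ : ℕ → ℤ) (σ : K →+* K) (ϖ : K) (d t : ℕ) :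
    FourFrameLawsWildAtR N₀ τ σ ϖ d t ↔ DyadicFence (K := K) (StableLawAt N₀ σ ϖ d t ∧ KappaAmplitudeLawAtR N₀ τ σ ϖ d t ∧ KappaSignLawAtR N₀ τ σ ϖ d t) :=
  Iff.rfl

/-- W-R · the closed re-cut laws imply the re-cut wild conjunction. -/
theorem fourFrameLawsWildR_of_laws (N₀ : ℕ → ℕ) (τ : ℕ → ℤ) (hS : StableLaw N₀) (hKA : KappaAmplitudeLawR N₀ τ) (hKS : KappaSignLawR N₀ τ) :
    FourFrameLawsWildR N₀ τ :=
  fourFrameLawsWildS_of_laws shiftR N₀ τ hS hKA hKS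

/-! ## §A  Agreement with the defs of record on the maximal types `d ∈ {t, t+1}` (every cell checked before e2c) -/

/-- A0 · behind a ramified quadratic datum `t = v_E(2)` is EVEN: `2` is `σ`-fixed and non-zero, and `σ`-fixed elements have even valuation (★ #0a D, conjunct 4). -/
theorem even_t_of_isRamifiedQuadraticDatum {K : Type} [Field K] [Valued K ℤᵐ⁰] {σ : K →+* K} {ϖ : K} {d t : ℕ}
    (hD : IsRamifiedQuadraticDatum σ ϖ d t) : t % 2 = 0 := by
  obtain ⟨-, -, hϖ, heven, -, -, h2⟩ := hD
  have hv2 : Valued.v (2 : K) = WithZero.exp (-(t : ℤ)) := by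
    rw [h2, hϖ, ← WithZero.exp_nsmul, nsmul_eq_mul, mul_neg, mul_one]
  have h20 : (2 : K) ≠ 0 := fun h => by
    rw [h, map_zero] at hv2
    exact WithZero.zero_ne_coe hv2
  obtain ⟨n, hn⟩ := heven 2 (map_ofNat σ 2) h20
  rw [hv2] at hn
  have := WithZero.exp_injective hn
  omega

/-- A1 · ON THE MAXIMAL TYPES THE TWO TOKENS ARE THE SAME INTEGER: `t` even and `d ∈ {t, t+1}` ⇒ `shiftR d t = shiftT d t` (i.e. `d − d mod 2 = t`). -/
theorem shiftR_eq_shiftT_of_maximal {d t : ℕ} (ht : t % 2 = 0) (h : d = t ∨ d = t + 1) : shiftR d t = shiftT d t := by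
  simp only [shiftR, shiftT]
  rcases h with rfl | rfl <;> omega

/-- A2 · AGREEMENT (K-ABS): behind the datum, on the maximal types `d ∈ {t, t+1}`, the re-cut cut IS the cut of record: `KappaAmplitudeLawAtR ↔ KappaAmplitudeLawAt`
(the custody tie for the 520∕520 + 14∕14 values of record, all of which have `d ∈ {t, t+1}`). -/
theorem kappaAmplitudeLawAtR_iff_of_maximal {K : Type} [Field K] [Valued K ℤᵐ⁰] [CompleteSpace K] [Fintype 𝓀[K]] (N₀ : ℕ → ℕ) (τ : ℕ → ℤ) (σ : K →+* K) (ϖ : K) {d t : ℕ}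
    (h : d = t ∨ d = t + 1) : KappaAmplitudeLawAtR N₀ τ σ ϖ d t ↔ KappaAmplitudeLawAt N₀ τ σ ϖ d t := by
  constructor
  · intro hR hD
    have key : shiftR d t = (t : ℤ) := shiftR_eq_shiftT_of_maximal (even_t_of_isRamifiedQuadraticDatum hD) h
    have h' := hR hD
    simp only [key] at h'
    exact h'
  · intro hA hD
    have key : (t : ℤ) = shiftR d t := (shiftR_eq_shiftT_of_maximal (even_t_of_isRamifiedQuadraticDatum hD) h).symm
    have h' := hA hD
    simp only [key] at h'
    exact h'

/-- A3 · AGREEMENT (K-SGN): on the maximal types, `KappaSignLawAtR ↔ KappaSignLawAt`. -/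
theorem kappaSignLawAtR_iff_of_maximal {K : Type} [Field K] [Valued K ℤᵐ⁰] [CompleteSpace K] [Fintype 𝓀[K]] (N₀ : ℕ → ℕ) (τ : ℕ → ℤ) (σ : K →+* K) (ϖ : K) {d t : ℕ}
    (h : d = t ∨ d = t + 1) : KappaSignLawAtR N₀ τ σ ϖ d t ↔ KappaSignLawAt N₀ τ σ ϖ d t := by
  constructor
  · intro hR hD
    have key : shiftR d t = (t : ℤ) := shiftR_eq_shiftT_of_maximal (even_t_of_isRamifiedQuadraticDatum hD) h
    have h' := hR hD
    simp only [key] at h'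
    exact h'
  · intro hA hD
    have key : (t : ℤ) = shiftR d t := (shiftR_eq_shiftT_of_maximal (even_t_of_isRamifiedQuadraticDatum hD) h).symm
    have h' := hA hD
    simp only [key] at h'
    exact h'

/-- A4 · AGREEMENT (fenced conjunction): on the maximal types, `FourFrameLawsWildAtR ↔ FourFrameLawsWildAt`. -/
theorem fourFrameLawsWildAtR_iff_of_maximal {K : Type} [Field K] [Valued K ℤᵐ⁰] [CompleteSpace K] [Fintype 𝓀[K]] (N₀ : ℕ → ℕ) (τ : ℕ → ℤ) (σ : K →+* K) (ϖ : K) {d t : ℕ}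
    (h : d = t ∨ d = t + 1) : FourFrameLawsWildAtR N₀ τ σ ϖ d t ↔ FourFrameLawsWildAt N₀ τ σ ϖ d t := by
  constructor
  · intro hR h2
    obtain ⟨hS, hKA, hKS⟩ := hR h2
    refine ⟨hS, ?_, ?_⟩
    · exact fun hD => (kappaAmplitudeLawAtR_iff_of_maximal N₀ τ σ ϖ h).1 hKA hD
    · exact fun hD => (kappaSignLawAtR_iff_of_maximal N₀ τ σ ϖ h).1 hKS hD
  · intro hA h2
    obtain ⟨hS, hKA, hKS⟩ := hA h2
    refine ⟨hS, ?_, ?_⟩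
    · exact fun hD => (kappaAmplitudeLawAtR_iff_of_maximal N₀ τ σ ϖ h).2 hKA hD
    · exact fun hD => (kappaSignLawAtR_iff_of_maximal N₀ τ σ ϖ h).2 hKS hD

end Summit.HodgeConjecture.HodgeConjecture.Cruxes.H413.F0P3cDyRamFourFrameLawDefsR

end
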